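import Summits.Ventures.PercRepro.C041CSUnion
import Summits.Ventures.PercRepro.C041ZoneOCubeUnionFin

/-!
# THE UNION LEMMA FOR (CS) OVER `n` COMPONENTS AND OVER ANY FINITE FAMILY (p6, gen 28; C-041.md §16 (ii))

Setting of `C041CSUnion` / `C041ZoneOCubeUnionPi` / `C041ZoneOCubeUnionFin`.  (CS) for a component in the
INDICATOR form — `CSInd v g h := (max (Σ[v] − Σ[g] − Σ[h]) 0)² ≤ Σ[g] · Σ[h]` — is transported along bijections
(`csInd_congr`), holds on the empty product (`csInd_pi_zero`), and is closed under the product of `n` components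
(`union_lemma_cs_pi`, induction on `n` through `Fin.consEquiv` and the two-component `union_lemma_cs`) and of any
finite family (**`union_lemma_cs_fintype`**, through `Fintype.equivFin` / `Equiv.piCongrLeft'`), with `valid`,
`g`, `h` the disjunctions over the components — the exact (CS) analogue of `union_lemma_pi` / `union_lemma_fintype`.
-/

namespace PercRepro

namespace ZoneOCube

open Finset

/-- (CS) for a component, in the indicator form. -/
def CSInd {S : Type*} [Fintype S] (v g h : S → Prop) : Prop :=
  (max ((∑ σ, ind (v σ)) - (∑ σ, ind (g σ)) - (∑ σ, ind (h σ))) 0) ^ 2 ≤ (∑ σ, ind (g σ)) * (∑ σ, ind (h σ))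

/-- The indicator form is transported along a bijection with pointwise equivalent predicates. -/
theorem csInd_congr {S T : Type*} [Fintype S] [Fintype T] {v g h : S → Prop} {v' g' h' : T → Prop} (e : S ≃ T)
    (hv : ∀ σ, v σ ↔ v' (e σ)) (hg : ∀ σ, g σ ↔ g' (e σ)) (hh : ∀ σ, h σ ↔ h' (e σ)) :
    CSInd v g h ↔ CSInd v' g' h' := by
  unfold CSInd
  rw [Fintype.sum_equiv e (fun σ => ind (v σ)) (fun τ => ind (v' τ)) (fun σ => ind_congr (hv σ)),
    Fintype.sum_equiv e (fun σ => ind (g σ)) (fun τ => ind (g' τ)) (fun σ => ind_congr (hg σ)),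
    Fintype.sum_equiv e (fun σ => ind (h σ)) (fun τ => ind (h' τ)) (fun σ => ind_congr (hh σ))]

/-- The two-component UNION LEMMA FOR (CS) in the indicator form. -/
theorem csInd_prod {S₁ S₂ : Type*} [Fintype S₁] [Fintype S₂] {v₁ g₁ h₁ : S₁ → Prop} {v₂ g₂ h₂ : S₂ → Prop}
    (hg₁ : ∀ σ, g₁ σ → v₁ σ) (hh₁ : ∀ σ, h₁ σ → v₁ σ) (hg₂ : ∀ τ, g₂ τ → v₂ τ) (hh₂ : ∀ τ, h₂ τ → v₂ τ)
    (H₁ : CSInd v₁ g₁ h₁) (H₂ : CSInd v₂ g₂ h₂) :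
    CSInd (fun x : S₁ × S₂ => v₁ x.1 ∨ v₂ x.2) (fun x => g₁ x.1 ∨ g₂ x.2) (fun x => h₁ x.1 ∨ h₂ x.2) :=
  union_lemma_cs hg₁ hh₁ hg₂ hh₂ H₁ H₂

/-- The empty product satisfies (CS): every sum is `0`. -/
theorem csInd_pi_zero {S : Fin 0 → Type*} [∀ i, Fintype (S i)] (v g h : ∀ i, S i → Prop) :
    CSInd (fun σ : ∀ i, S i => ∃ i, v i (σ i)) (fun σ => ∃ i, g i (σ i)) (fun σ => ∃ i, h i (σ i)) := by
  unfold CSInd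
  have e : ∀ p : ∀ i, S i → Prop, (∑ σ : ∀ i, S i, ind (∃ i, p i (σ i))) = 0 := by
    intro p
    apply Finset.sum_eq_zero
    intro σ _
    exact ind_of_false (fun ⟨i, _⟩ => i.elim0)
  rw [e v, e g, e h]
  simp

/-- **THE UNION LEMMA FOR (CS) OVER `n` COMPONENTS**: if every component has `G_t ⇒ valid` and satisfies (CS), so
does the product with the disjunctions. -/
theorem union_lemma_cs_pi {n : ℕ} {S : Fin n → Type*} [∀ i, Fintype (S i)] (v g h : ∀ i, S i → Prop)
    (hg : ∀ i σ, g i σ → v i σ) (hh : ∀ i σ, h i σ → v i σ) (H : ∀ i, CSInd (v i) (g i) (h i)) :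
    CSInd (fun σ : ∀ i, S i => ∃ i, v i (σ i)) (fun σ => ∃ i, g i (σ i)) (fun σ => ∃ i, h i (σ i)) := by
  induction n with
  | zero => exact csInd_pi_zero v g h
  | succ n ih =>
    have ih' := ih (fun i => v i.succ) (fun i => g i.succ) (fun i => h i.succ) (fun i σ => hg _ σ)
      (fun i σ => hh _ σ) (fun i => H i.succ)
    have key := csInd_prod (hg 0) (hh 0) (fun t ⟨i, hi⟩ => ⟨i, hg _ _ hi⟩) (fun t ⟨i, hi⟩ => ⟨i, hh _ _ hi⟩)
      (H 0) ih'
    rw [csInd_congr (Fin.consEquiv S) (fun p => ?_) (fun p => ?_) (fun p => ?_)] at key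
    · exact key
    · exact (exists_cons_iff v p.1 p.2).symm
    · exact (exists_cons_iff g p.1 p.2).symm
    · exact (exists_cons_iff h p.1 p.2).symm

/-- **THE UNION LEMMA FOR (CS) OVER ANY FINITE FAMILY OF COMPONENTS.** -/
theorem union_lemma_cs_fintype {ι : Type*} [Fintype ι] [DecidableEq ι] {S : ι → Type*} [∀ i, Fintype (S i)]
    (v g h : ∀ i, S i → Prop) (hg : ∀ i σ, g i σ → v i σ) (hh : ∀ i σ, h i σ → v i σ)
    (H : ∀ i, CSInd (v i) (g i) (h i)) :
    CSInd (fun σ : ∀ i, S i => ∃ i, v i (σ i)) (fun σ => ∃ i, g i (σ i)) (fun σ => ∃ i, h i (σ i)) := by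
  set e := Fintype.equivFin ι
  have key := union_lemma_cs_pi (S := fun j => S (e.symm j)) (fun j => v (e.symm j)) (fun j => g (e.symm j))
    (fun j => h (e.symm j)) (fun j σ => hg _ σ) (fun j σ => hh _ σ) (fun j => H (e.symm j))
  rw [← csInd_congr (Equiv.piCongrLeft' S e) (fun σ => ?_) (fun σ => ?_) (fun σ => ?_)] at key
  · exact key
  · exact (exists_piCongrLeft'_iff v e σ).symm
  · exact (exists_piCongrLeft'_iff g e σ).symm
  · exact (exists_piCongrLeft'_iff h e σ).symm

end ZoneOCube

end PercRepro
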